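import Mathlib
import Summits.AtomisticToContinuum.Crystallization.Theses.HullMinimality

/-!
# Assembly of route `HullMinimality`
(item `stmt-AtomisticToContinuum-11781`, decl `Assembly`:
`LayeredWindows → PeriodicGivenLayered → HullCriterion → CrysPeriodicMinAttained → CrysEnergyLimit →
Crystallization`)

PROOF (pure logic, the same five lines as the route's deciding theorem `closes`).
* Conjunct (ii): per sequence of Lennard-Jones ground states, `LayeredWindows` and
  `PeriodicGivenLayered` give `PeriodicWindows` by modus ponens, and `HullCriterion` turns it into
  `IsCrystallizing lennardJones 3`.
* Conjunct (i): `CrysPeriodicMinAttained` gives a periodic configuration `P` whose energy per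
  particle is the least value over periodic configurations, hence equals the infimum
  (`IsLeast.csInf_eq`); rewriting the limit in `CrysEnergyLimit` gives
  `E(N)/N → e(P)`, i.e. `HasPeriodicGroundStateEnergy lennardJones 3`.
The pair is `Crystallization` (Blanc–Lewin 2015, §2.1 (15)–(18)).
-/

namespace Summit.AtomisticToContinuum.Crystallization.Theorems

open Summit.AtomisticToContinuum.Crystallization.Theses
open Literature.MathematicalPhysics.StatisticalMechanics

/-- The assembly of route `HullMinimality` (item `stmt-AtomisticToContinuum-11781`): layered
windows, stacking selection inside the hull, the hull criterion, attainment of the periodic minimum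
and the energy limit together give both conjuncts of Blanc–Lewin crystallization for Lennard-Jones
in `ℝ³`. -/
theorem hullMinimality_assembly_proof : HullMinimality.Assembly := by
  unfold HullMinimality.Assembly
  intro h_LayeredWindows h_PeriodicGivenLayered h_HullCriterion h_CrysPeriodicMinAttained
    h_CrysEnergyLimit
  -- conjunct (ii): the two cruxes give PeriodicWindows, the hull criterion gives IsCrystallizing
  have hPW : HullMinimality.PeriodicWindows :=
    fun x hx => h_PeriodicGivenLayered x hx (h_LayeredWindows x hx)
  have hii : IsCrystallizing lennardJones 3 := h_HullCriterion hPW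
  -- conjunct (i): the least periodic value is the infimum, so E(N)/N → e(P)
  obtain ⟨P, hP⟩ := h_CrysPeriodicMinAttained
  have h : (⨅ Q : PeriodicConfiguration 3, Q.energyPerParticle lennardJones) =
      P.energyPerParticle lennardJones := hP.csInf_eq
  have hT := h_CrysEnergyLimit
  unfold HullMinimality.CrysEnergyLimit at hT
  rw [h] at hT
  exact ⟨⟨P, hP, hT⟩, hii⟩

end Summit.AtomisticToContinuum.Crystallization.Theorems
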